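import Mathlib

/-!
# Cuspidal descent — arithmetic certificate for memo `CuspidalDescentThetaMatch-g36.md` (K1b′(ii))

Crux `EllipticUnitValueSevenOfGZK` (stmt-BirchSwinnertonDyer-19945), idea card
`Ideas/cuspidal-descent-kolyvagin-nonvanishing.md`.  **No summit statement is proved here.**
These are the finitely many residue computations mod 7 that Theorem T of the memo uses, plus the
`|G| = 14` instance of the group-ring identity "Lemma D" (`D_G = D̃_a N_K + a Ñ_a D_K`), all by `decide`.

* `twist_scalar_unit`  : the twisting scalar `N𝔤 − ρ̃(σ_𝔤) = q² − q⁴` is a 7-adic unit for `q ≢ 0, ±1 (mod 7)`;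
* `sigma_g_eigenvalue` : `ρ̃(σ_{(q)}) = ω⁵(q²) = q¹⁰ = q⁴` in `𝔽₇`;
* `rubin_prime_splits` : `ℓ ≡ −1 (mod 7) ⇒ ρ̃(σ_λ) = (ℓ²)⁵ = 1` (λ = ℓ𝒪 splits completely in `F`);
* `ray_to_ring`        : `ℓ ≡ −1 (mod 7) ⇒ 7 ∤ ℓ − 1` (`𝔽_ℓ^× ⊂ ker(A_ℓ → P_ℓ)`);
* `tame_part_trivial`  : `n ≡ ±1 (mod 7) ⇒ n¹⁰ = 1` (Lemma C: `ε = 1` for `τ = Ω/(7|D|)`);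
* `layer_thirteen`     : for `ℓ = 13`: `(ℓ²−1)/2 = 84 = 7·12`, `gcd(12,7) = 1`, `ℓ+1 = 14 = 7·2`;
* `dLemma_coeff`, `dLemma_fourteen` : Lemma D (coefficientwise it is `i = i % a + a·(i / a)`), and its
  convolution form for the cyclic group of order `14 = 7·2` checked by `decide`.
-/

set_option linter.dupNamespace false

namespace Summit.BirchSwinnertonDyer.BirchSwinnertonDyer.Cruxes.EllipticUnitValueSevenOfGZK.CuspidalDescent.ThetaExponents

theorem twist_scalar_unit :
    ∀ q : ZMod 7, q ≠ 0 → q ≠ 1 → q ≠ -1 → q ^ 2 - q ^ 4 ≠ 0 := by decide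

theorem sigma_g_eigenvalue : ∀ q : ZMod 7, q ≠ 0 → q ^ 10 = q ^ 4 := by decide

theorem rubin_prime_splits : ∀ l : ZMod 7, l = -1 → (l ^ 2) ^ 5 = 1 := by decide

theorem ray_to_ring : ∀ l : ZMod 7, l = -1 → l - 1 ≠ 0 := by decide

theorem tame_part_trivial : ∀ n : ZMod 7, (n = 1 ∨ n = -1) → n ^ 10 = 1 := by decide

theorem layer_thirteen :
    (13 ^ 2 - 1) / 2 = 84 ∧ 84 = 7 * 12 ∧ Nat.Coprime 12 7 ∧ 13 + 1 = 7 * 2 ∧ 13 % 7 = 6 := by decide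

/-- Lemma D, coefficientwise: the coefficient `i` of `σ^i` in `D_G = Σ_{i<ab} i σ^i` equals
`(i mod a)·1 + a·(i div a)`, the coefficient of `σ^i = σ^{i mod a}·(σ^a)^{i div a}` in `D̃_a N_K + a Ñ_a D_K`. -/
theorem dLemma_coeff (a i : ℕ) : i = i % a + a * (i / a) := (Nat.mod_add_div i a).symm

/-- Hence `D_G ≡ D̃_a N_K (mod a)` coefficientwise. -/
theorem dLemma_coeff_mod (a i : ℕ) : (i : ZMod a) = ((i % a : ℕ) : ZMod a) := by
  rw [ZMod.natCast_mod]

/-- Lemma D in convolution form for the cyclic group `ℤ/14` (`a = 7`, `b = 2`; the layer of the inert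
Kolyvagin prime `ℓ = 13` at `k = 1`): for every residue `i`, summing `j` (resp. `7·t`) over the pairs
`(j,t) ∈ [0,7) × [0,2)` with `j + 7t ≡ i (mod 14)` returns `i` — i.e. `D̃₇ N_K + 7 Ñ₇ D_K = D_G`. -/
theorem dLemma_fourteen :
    ∀ i : Fin 14,
      ((Finset.univ : Finset (Fin 7 × Fin 2)).sum
          (fun p => if (p.1.val + 7 * p.2.val) % 14 = i.val then (p.1.val : ℤ) + 7 * p.2.val else 0))
        = i.val := by decide

end Summit.BirchSwinnertonDyer.BirchSwinnertonDyer.Cruxes.EllipticUnitValueSevenOfGZK.CuspidalDescent.ThetaExponents
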